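import Summits.Ventures.PercRepro.RankLevelSetTightContract
import Summits.Ventures.PercRepro.RankLevelSetTightTails
import Summits.Ventures.PercRepro.RankLevelSetTightArithBS

/-!
# PercRepro — [re-pointed at the primed (`_S`) parents per (um)(35)(2)–(4); the landed originals are the citations]
# THE TIGHT LAYER OF (MC) AT AN ELEMENT IN NO CIRCUIT OF SIZE ≤ q (night-1, gen 9; §19.6–19.7)

On the tight layer `|E| = p + q`, for a non-loop `e` every circuit through which has `≥ q + 1` elements:

  `σ_M(p,q) − σ_{M／e}(p−1,q) ≥ [τ′_M − τ′_{M／e}] + Φ(p,q)·#bad(M) − Φ(p−1,q)·#bad(M／e)`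
  (RankLevelSetTightLayer / TightContract), `#bad(M／e) ≤ #bad(M) + b″(e)` (`ncard_badImg_contract_le_add`),
  `τ′_M − τ′_{M／e} ≥ #xSets_S · w(p,q)` with `w(p,q) = Σ_{q<u<p} C(p−1,u)/C(p+q−u,p−u) + (C(p−1,q) − 1)/C(p−1,q)`
  (RankLevelSetTightSurplus + TightPairs), and `#xSets_S ≥ (p − q)·b″(e)` (RankLevelSetTightTails).

So `σ_{M／e}(p−1,q) ≤ σ_M(p,q)` follows from the binomial inequality `J(p,q): Φ(p−1,q) ≤ (p − q)·w(p,q)`,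
which RankLevelSetTightArithB proves for every `q ≥ 1`, `p ≥ q + 2` (`phiK_pred_le_mul_weight_S`):

* `slack_contract_le_of_tight_of_long_circuits` — the theorem given `J(p,q)` as a hypothesis;
* **`slack_contract_le_of_tight_of_no_short_circuit`** — UNCONDITIONAL: for a finite matroid with
  `|E| = p + q`, `1 ≤ q`, `q + 2 ≤ p`, and a non-loop `e` every circuit through which has at least `q + 1`
  elements, `σ_{M ／ {e}}(p − 1, q) ≤ σ_M(p, q)` — (MC), hence (MC-2) = C-037, at `e`;
* **`slack_contract_le_of_tight_two_of_simple`** — at `q = 2`: every element of every SIMPLE matroid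
  (no loops, every pair of distinct elements of rank 2 — the cell's core hypothesis) on `p + 2` elements;
* `slack_contract_le_of_tight_of_girth` — every non-loop of a matroid of girth `≥ q + 1` on the tight layer;
* `contractMonoTwo_of_tight_of_no_short_circuit` — the (MC-2) form of C-037 at such an element.

Axioms: standard.
-/

open scoped Matroid

namespace PercRepro

open Set Finset
open scoped Classical

variable {α : Type} (M : Matroid α) [M.Finite]

/-- The weight of one member of `xSets_S` in the surplus. -/
noncomputable def xWeight (p q : ℕ) : ℚ :=
  ∑ u ∈ Finset.Ioo q p, ((p - 1).choose u : ℚ) / ((p + q - u).choose (p - u) : ℚ) +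
    (((p - 1).choose q : ℚ) - 1) / ((p - 1).choose q : ℚ)

/-- `0 ≤ xWeight` (for `q ≤ p − 1`). -/
lemma xWeight_nonneg {p q : ℕ} (hq : q ≤ p - 1) : 0 ≤ xWeight p q := by
  unfold xWeight
  have h1 : (1 : ℚ) ≤ ((p - 1).choose q : ℚ) := by exact_mod_cast Nat.choose_pos hq
  refine add_nonneg (Finset.sum_nonneg (fun u _ => by positivity)) ?_
  apply div_nonneg (by linarith) (by positivity)

/-- **The surplus is at least `#xSets_S · xWeight`** (tight layer, circuits through `e` of size `≥ q + 1`). -/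
lemma xSets_mul_xWeight_le_indepSlack_sub {e : α} (he : M.IsNonloop e) {p q : ℕ} (hq : 1 ≤ q)
    (hpq : q + 2 ≤ p) (hE : M.E.ncard = p + q)
    (hc : ∀ C : Set α, M.IsCircuit C → e ∈ C → ((q + 1 : ℕ) : ℕ∞) ≤ C.encard) :
    ((xSets_S M e p).card : ℚ) * xWeight p q ≤ indepSlack M p q - indepSlack (M ／ {e}) (p - 1) q := by
  rw [indepSlack_sub_contract_eq M he hq hpq (by omega), hE]
  have hsym : (p + q - 1 - q).choose (p - 1 - q) = (p - 1).choose q := by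
    rw [show p + q - 1 - q = p - 1 by omega]
    rw [← Nat.choose_symm (by omega : q ≤ p - 1)]
  rw [hsym]
  unfold xWeight
  rw [mul_add, Finset.mul_sum]
  refine add_le_add ?_ ?_
  · refine Finset.sum_le_sum (fun u hu => ?_)
    rw [Finset.mem_Ioo] at hu
    have hpos : (0 : ℚ) < ((p + q - u).choose (p - u) : ℚ) := by
      exact_mod_cast Nat.choose_pos (by omega)
    rw [← mul_div_assoc]
    apply div_le_div_of_nonneg_right _ hpos.le
    exact_mod_cast xSets_mul_choose_le_depSumAvoid_S M e u p
  · have hpos : (0 : ℚ) < ((p - 1).choose q : ℚ) := by exact_mod_cast Nat.choose_pos (by omega)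
    rw [← mul_div_assoc]
    apply div_le_div_of_nonneg_right _ hpos.le
    have h := xSets_mul_choose_pred_le_sum_depCount_contract_S M he p q hc
    have h1 : (1 : ℕ) ≤ (p - 1).choose q := Nat.choose_pos (by omega)
    have h2 : (((p - 1).choose q - 1 : ℕ) : ℚ) = ((p - 1).choose q : ℚ) - 1 := by
      rw [Nat.cast_sub h1]
      push_cast
      ring
    rw [← h2]
    exact_mod_cast h

/-- `#bad(M／e) ≤ #bad(M) + b″(e)`: the injection `A′ ↦ insert e A′` lands in `bad(M)` unless the complement
is independent, in which case `e ∈ cl(E ∖ A)` and the set is counted by `bSets`. -/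
lemma ncard_badImg_contract_le_add {e : α} (he : M.IsNonloop e) {p : ℕ} (hp : 1 ≤ p) :
    (badImg (M ／ {e}) (p - 1)).ncard ≤ (badImg M p).ncard + (bSets M e p).card := by
  have hEfin : M.E.Finite := M.set_finite M.E
  have hefin : (M ／ {e}).Finite := inferInstance
  have hfin : (badImg M p ∪ (fun s : Finset α => (s : Set α)) '' ↑(bSets M e p)).Finite :=
    ((indImg_finite M p).sdiff).union ((Finset.finite_toSet _).image _)
  have hcard : ((fun s : Finset α => (s : Set α)) '' ↑(bSets M e p)).ncard = (bSets M e p).card := by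
    rw [ncard_image_of_injective _ Finset.coe_injective, ncard_coe_finset]
  calc (badImg (M ／ {e}) (p - 1)).ncard
      ≤ (badImg M p ∪ (fun s : Finset α => (s : Set α)) '' ↑(bSets M e p)).ncard := by
        refine ncard_le_ncard_of_injOn (fun A => insert e A) ?_ ?_ hfin
        · rintro A ⟨hA, hbad⟩
          have hA' := hA
          unfold indImg at hA'
          obtain ⟨s, hs, rfl⟩ := hA'
          rw [Finset.mem_coe, mem_indepSets (M ／ {e})] at hs
          obtain ⟨hsE, hscard, hsind⟩ := hs
          rw [toFinset_contract_ground] at hsE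
          have hes : e ∉ s := fun h => (Finset.mem_erase.1 (hsE h)).1 rfl
          have hind' : M.Indep (insert e (s : Set α)) := (he.contractElem_indep_iff.1 hsind).2
          have hsE' : insert e s ⊆ groundFinset_S M := by
            intro x hx
            rw [Finset.mem_insert] at hx
            rcases hx with rfl | hx
            · rw [(M.set_finite M.E).mem_toFinset]; exact he.mem_ground
            · exact (Finset.mem_erase.1 (hsE hx)).2
          have hmem : insert e s ∈ indepSets M p := by
            rw [mem_indepSets M]
            refine ⟨hsE', ?_, by rw [Finset.coe_insert]; exact hind'⟩
            rw [Finset.card_insert_of_notMem hes, hscard]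
            omega
          have hcoe : insert e ((s : Finset α) : Set α) = ((insert e s : Finset α) : Set α) := by
            rw [Finset.coe_insert]
          have hsdiff : M.E \ insert e ((s : Finset α) : Set α) =
              ((groundFinset_S M \ insert e s : Finset α) : Set α) := by
            rw [coe_ground_sdiff, hcoe]
          by_cases hcomp : M.Indep (M.E \ insert e ((s : Finset α) : Set α))
          · right
            refine ⟨insert e s, ?_, hcoe.symm⟩
            rw [Finset.mem_coe]
            unfold bSets
            rw [Finset.mem_filter]
            refine ⟨hmem, Finset.mem_insert_self e s, ?_, ?_⟩
            · rw [← hsdiff]; exact hcomp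
            · rw [← hsdiff]
              by_contra hcl
              apply hbad
              change (M ／ {e}).Indep ((M ／ {e}).E \ (s : Set α))
              rw [← ground_sdiff_insert M e (s : Set α)]
              have hnot : e ∉ M.E \ insert e ((s : Finset α) : Set α) := fun h => h.2 (mem_insert e _)
              rw [he.contractElem_indep_iff]
              refine ⟨hnot, ?_⟩
              rw [hcomp.insert_indep_iff_of_notMem hnot]
              exact ⟨he.mem_ground, hcl⟩
          · left
            refine ⟨?_, hcomp⟩
            unfold indImg
            exact ⟨insert e s, by rw [Finset.mem_coe]; exact hmem, hcoe.symm⟩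
        · rintro A ⟨hA, -⟩ A' ⟨hA', -⟩ hEq
          rw [mem_indImg_iff] at hA hA'
          have heA : e ∉ A := fun h => (hA.1 h).2 rfl
          have heA' : e ∉ A' := fun h => (hA'.1 h).2 rfl
          have h1 : insert e A \ {e} = insert e A' \ {e} := by
            simp only at hEq
            rw [hEq]
          rwa [insert_sdiff_self_of_notMem heA, insert_sdiff_self_of_notMem heA'] at h1
    _ ≤ (badImg M p).ncard + ((fun s : Finset α => (s : Set α)) '' ↑(bSets M e p)).ncard :=
        ncard_union_le _ _
    _ = (badImg M p).ncard + (bSets M e p).card := by rw [hcard]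

/-- **THE TIGHT LAYER OF (MC) AT AN ELEMENT IN NO CIRCUIT OF SIZE ≤ q** (given the binomial inequality
`J(p,q)`): `|E| = p + q`, `1 ≤ q`, `q + 2 ≤ p`, `e` a non-loop with every circuit through `e` of size
`≥ q + 1`; then `σ_{M ／ {e}}(p − 1, q) ≤ σ_M(p, q)`. -/
theorem slack_contract_le_of_tight_of_long_circuits {e : α} (he : M.IsNonloop e) {p q : ℕ} (hq : 1 ≤ q)
    (hpq : q + 2 ≤ p) (hE : M.E.ncard = p + q)
    (hc : ∀ C : Set α, M.IsCircuit C → e ∈ C → ((q + 1 : ℕ) : ℕ∞) ≤ C.encard)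
    (hJ : phiK (p - 1) q ≤ ((p - q : ℕ) : ℚ) * xWeight p q) :
    Matroid.slack (M ／ {e}) (p - 1) q ≤ Matroid.slack M p q := by
  have hefin : (M ／ {e}).Finite := inferInstance
  have hE' : (M ／ {e}).E.ncard = (p - 1) + q := by
    rw [Matroid.contract_ground, ncard_sdiff_singleton_of_mem he.mem_ground, hE]
    omega
  unfold Matroid.slack
  -- Y side
  have hY := sum_add_ncard_depMid_le_midCount M p q
  have hY' := midCount_le_sum_add_ncard_depMid (M ／ {e}) (p - 1) q
  have hdep := ncard_depMid_contract_le M he (p := p) (q := q) (by omega)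
  -- U side
  have hU := topCount_le_ncard_goodImg M hE
  have hU' := ncard_goodImg_le_topCount (M ／ {e}) hE'
  have hgb := ncard_goodImg_add_ncard_badImg M p
  have hgb' := ncard_goodImg_add_ncard_badImg (M ／ {e}) (p - 1)
  have hbad := ncard_badImg_contract_le_add M he (p := p) (by omega)
  -- the surplus
  have hsur := xSets_mul_xWeight_le_indepSlack_sub M he hq hpq hE hc
  have hxs := mul_card_bSets_le_card_xSets M hE (by omega) hc
  rw [indepSlack_eq_of_ncard_eq M hE, indepSlack_eq_of_ncard_eq (M ／ {e}) hE'] at hsur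
  have hw := xWeight_nonneg (p := p) (q := q) (by omega)
  -- Φ monotonicity
  have hphi := phiK_pred_le p q hpq
  have hphi0 := phiK_nonneg' (p - 1) q
  -- casts
  have hY_q : (∑ u ∈ Finset.Ioo q p, ((indepSets M u).card : ℚ)) + ((depMid M p q).ncard : ℚ) ≤
      (Matroid.midCount M p q : ℚ) := by exact_mod_cast hY
  have hY'_q : (Matroid.midCount (M ／ {e}) (p - 1) q : ℚ) ≤
      (∑ u ∈ Finset.Ioo q (p - 1), ((indepSets (M ／ {e}) u).card : ℚ)) +
        ((depMid (M ／ {e}) (p - 1) q).ncard : ℚ) := by exact_mod_cast hY'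
  have hdep_q : ((depMid (M ／ {e}) (p - 1) q).ncard : ℚ) ≤ ((depMid M p q).ncard : ℚ) := by
    exact_mod_cast hdep
  have hU_q : (Matroid.topCount M p q : ℚ) ≤ ((goodImg M p).ncard : ℚ) := by exact_mod_cast hU
  have hU'_q : ((goodImg (M ／ {e}) (p - 1)).ncard : ℚ) ≤ (Matroid.topCount (M ／ {e}) (p - 1) q : ℚ) := by
    exact_mod_cast hU'
  have hgb_q : ((goodImg M p).ncard : ℚ) + ((badImg M p).ncard : ℚ) = ((indepSets M p).card : ℚ) := by
    exact_mod_cast hgb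
  have hgb'_q : ((goodImg (M ／ {e}) (p - 1)).ncard : ℚ) + ((badImg (M ／ {e}) (p - 1)).ncard : ℚ) =
      ((indepSets (M ／ {e}) (p - 1)).card : ℚ) := by exact_mod_cast hgb'
  have hbad_q : ((badImg (M ／ {e}) (p - 1)).ncard : ℚ) ≤
      ((badImg M p).ncard : ℚ) + ((bSets M e p).card : ℚ) := by exact_mod_cast hbad
  have hxs_q : ((p - q : ℕ) : ℚ) * ((bSets M e p).card : ℚ) ≤ ((xSets_S M e p).card : ℚ) := by
    exact_mod_cast hxs
  have hbad0 : (0 : ℚ) ≤ ((badImg M p).ncard : ℚ) := by positivity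
  have hb0 : (0 : ℚ) ≤ ((bSets M e p).card : ℚ) := by positivity
  -- the surplus pays `Φ′·b″`
  have hpay : phiK (p - 1) q * ((bSets M e p).card : ℚ) ≤
      (∑ u ∈ Finset.Ioo q p, ((indepSets M u).card : ℚ) - phiK p q * ((indepSets M p).card : ℚ)) -
        (∑ u ∈ Finset.Ioo q (p - 1), ((indepSets (M ／ {e}) u).card : ℚ) -
          phiK (p - 1) q * ((indepSets (M ／ {e}) (p - 1)).card : ℚ)) := by
    refine le_trans ?_ hsur
    calc phiK (p - 1) q * ((bSets M e p).card : ℚ)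
        ≤ ((p - q : ℕ) : ℚ) * xWeight p q * ((bSets M e p).card : ℚ) :=
          mul_le_mul_of_nonneg_right hJ hb0
      _ = ((p - q : ℕ) : ℚ) * ((bSets M e p).card : ℚ) * xWeight p q := by ring
      _ ≤ ((xSets_S M e p).card : ℚ) * xWeight p q := mul_le_mul_of_nonneg_right hxs_q hw
  -- Φ′·bad′ ≤ Φ′·(bad + b″), Φ′·bad ≤ Φ·bad
  have hm1 : phiK (p - 1) q * ((badImg (M ／ {e}) (p - 1)).ncard : ℚ) ≤
      phiK (p - 1) q * (((badImg M p).ncard : ℚ) + ((bSets M e p).card : ℚ)) :=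
    mul_le_mul_of_nonneg_left hbad_q hphi0
  have hm2 : phiK (p - 1) q * ((badImg M p).ncard : ℚ) ≤ phiK p q * ((badImg M p).ncard : ℚ) :=
    mul_le_mul_of_nonneg_right hphi hbad0
  have hm3 : phiK p q * (Matroid.topCount M p q : ℚ) ≤ phiK p q * ((goodImg M p).ncard : ℚ) :=
    mul_le_mul_of_nonneg_left hU_q (phiK_nonneg' p q)
  have hm4 : phiK (p - 1) q * ((goodImg (M ／ {e}) (p - 1)).ncard : ℚ) ≤
      phiK (p - 1) q * (Matroid.topCount (M ／ {e}) (p - 1) q : ℚ) :=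
    mul_le_mul_of_nonneg_left hU'_q hphi0
  have hg : ((goodImg M p).ncard : ℚ) = ((indepSets M p).card : ℚ) - ((badImg M p).ncard : ℚ) := by
    linarith
  have hg' : ((goodImg (M ／ {e}) (p - 1)).ncard : ℚ) =
      ((indepSets (M ／ {e}) (p - 1)).card : ℚ) - ((badImg (M ／ {e}) (p - 1)).ncard : ℚ) := by
    linarith
  rw [hg] at hm3
  rw [hg'] at hm4
  nlinarith [hm1, hm2, hm3, hm4, hpay, hY_q, hY'_q, hdep_q]

/-- **THE TIGHT LAYER OF (MC) AT AN ELEMENT IN NO CIRCUIT OF SIZE ≤ q** (unconditional). -/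
theorem slack_contract_le_of_tight_of_no_short_circuit {e : α} (he : M.IsNonloop e) {p q : ℕ}
    (hq : 1 ≤ q) (hpq : q + 2 ≤ p) (hE : M.E.ncard = p + q)
    (hc : ∀ C : Set α, M.IsCircuit C → e ∈ C → ((q + 1 : ℕ) : ℕ∞) ≤ C.encard) :
    Matroid.slack (M ／ {e}) (p - 1) q ≤ Matroid.slack M p q :=
  slack_contract_le_of_tight_of_long_circuits M he hq hpq hE hc
    (by unfold xWeight; exact phiK_pred_le_mul_weight_S hq hpq)


/-- **THE q = 2 TIGHT LAYER OF (MC) FOR SIMPLE MATROIDS**: `|E| = p + 2`, `4 ≤ p`, every pair of distinct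
elements of rank `2`; then `σ_{M ／ {e}}(p − 1, 2) ≤ σ_M(p, 2)` at every element `e ∈ E`. -/
theorem slack_contract_le_of_tight_two_of_simple {p : ℕ} (hp : 4 ≤ p) (hE : M.E.ncard = p + 2)
    (hs : ∀ e f, e ∈ M.E → f ∈ M.E → e ≠ f → M.eRk {e, f} = 2) {e : α} (heE : e ∈ M.E) :
    Matroid.slack (M ／ {e}) (p - 1) 2 ≤ Matroid.slack M p 2 := by
  have hEfin : M.E.Finite := M.set_finite M.E
  -- `e` is a non-loop: a loop would make `r{e, f} = r{f} ≤ 1` for any other `f`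
  have he : M.IsNonloop e := by
    by_contra hl
    rw [Matroid.not_isNonloop_iff heE] at hl
    obtain ⟨f, hfE, hfe⟩ := Set.exists_ne_of_one_lt_ncard (by omega : 1 < M.E.ncard) e
    have h2 := hs e f heE hfE hfe.symm
    have h1 : M.eRk {e, f} = M.eRk {f} :=
      eRk_insert_eq_of_mem_closure (Set.singleton_subset_iff.2 hfE) (hl.mem_closure {f})
    have h3 : M.eRk {f} ≤ 1 := by
      have := M.eRk_le_encard {f}
      rwa [Set.encard_singleton] at this
    rw [h1] at h2
    rw [h2] at h3
    exact absurd h3 (by norm_num)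
  refine slack_contract_le_of_tight_of_no_short_circuit M he (by norm_num) (by omega) hE ?_
  intro C hC heC
  have hCfin : C.Finite := hEfin.subset hC.subset_ground
  by_contra hlt
  rw [not_le, ← hCfin.cast_ncard_eq] at hlt
  have hlt' : C.ncard < 2 + 1 := by exact_mod_cast hlt
  have hne : C.ncard ≠ 0 := by
    rw [Ne, Set.ncard_eq_zero hCfin]
    exact hC.nonempty.ne_empty
  rcases (by omega : C.ncard = 1 ∨ C.ncard = 2) with h1 | h2
  · obtain ⟨x, rfl⟩ := Set.ncard_eq_one.1 h1
    rw [Set.mem_singleton_iff] at heC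
    subst heC
    exact hC.not_indep he.indep
  · obtain ⟨x, y, hxy, rfl⟩ := Set.ncard_eq_two.1 h2
    have hxE : x ∈ M.E := hC.subset_ground (Set.mem_insert x {y})
    have hyE : y ∈ M.E := hC.subset_ground (Set.mem_insert_of_mem x rfl)
    have hr := hs x y hxE hyE hxy
    apply hC.not_indep
    rw [Matroid.indep_iff_eRk_eq_encard_of_finite hCfin, hr, Set.encard_pair hxy]


/-- **GIRTH ≥ q + 1**: on the tight layer, (MC) holds at every non-loop of a matroid all of whose circuits have
at least `q + 1` elements. -/
theorem slack_contract_le_of_tight_of_girth {e : α} (he : M.IsNonloop e) {p q : ℕ}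
    (hq : 1 ≤ q) (hpq : q + 2 ≤ p) (hE : M.E.ncard = p + q)
    (hg : ∀ C : Set α, M.IsCircuit C → ((q + 1 : ℕ) : ℕ∞) ≤ C.encard) :
    Matroid.slack (M ／ {e}) (p - 1) q ≤ Matroid.slack M p q :=
  slack_contract_le_of_tight_of_no_short_circuit M he hq hpq hE (fun C hC _ => hg C hC)

/-- **THE (MC-2) FORM** (the row C-037 as typed in RankLevelSetContractMonoTwo) at an element of the tight
layer in no circuit of size `≤ q`. -/
theorem contractMonoTwo_of_tight_of_no_short_circuit {e : α} (he : M.IsNonloop e) {p q : ℕ}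
    (hq : 1 ≤ q) (hpq : q + 2 ≤ p) (hE : M.E.ncard = p + q)
    (hc : ∀ C : Set α, M.IsCircuit C → e ∈ C → ((q + 1 : ℕ) : ℕ∞) ≤ C.encard) :
    min (Matroid.slack (M ／ {e}) (p - 1) q) (Matroid.slack (M ／ {e}) (p - 1) (q - 1)) ≤
      Matroid.slack M p q :=
  le_trans (min_le_left _ _) (slack_contract_le_of_tight_of_no_short_circuit M he hq hpq hE hc)


end PercRepro
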